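import Literature.Probability.RandomPlanarGeometry.SLETransienceSimple
import Literature.Probability.RandomPlanarGeometry.LoewnerRealKoebe
import HarnessLib

/-!
# Avoidance of the real line by the SLE_κ trace from bounds on `g_t'(x)/g_t'(y)` (Rohde–Schramm, Lemma 7.2)

Trunk T-STOCH. S. Rohde, O. Schramm, *Basic properties of SLE*, Ann. of Math. 161 (2005),
Lemma 7.2 (p. 909): "Suppose that `κ ≤ 4`, and let `x ∈ ℝ ∖ {0}`. Then a.s. `x ∉ cl γ[0, ∞)`."
This file proves the **deterministic and symmetry parts** of the Koebe route to this lemma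
(the printed `κ = 4` argument: "it suffices to show that a.s. `sup_{t ≥ 0} Q(t) < ∞`"), so that
only the stochastic bound `sup_t (log g_t'(x) - log g_t'(y)) < ∞` remains:

* `Loewner.log_norm_deriv_map_ofReal_sub_eq_integral` — for `W 0 < y ≤ x`, `t < T_y`:
  `log |g_t'(x)| - log |g_t'(y)| = ∫₀ᵗ (2/Y_s² - 2/X_s²) ds` (`log |g_t'(z)| = -2 ∫₀ᵗ ds/Z_s²`,
  `LoewnerRealKoebe`);
* `Loewner.IsGeneratedByCurve.ofReal_notMem_closure_range_of_bounds` (**deterministic**): for a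
  chain from `0` generated by `γ`, if no positive rational is swallowed and, for every pair of
  rationals `0 < q < q'`, `sup_t (log |g_t'(q')| - log |g_t'(q)|) < ∞`, then **no positive real
  point lies in `cl γ[0, ∞)`**: given `x > 0` choose rationals `0 < q < x ≤ q'`; the Koebe bound
  (`IsGeneratedByCurve.le_dist_apply_ofReal'`) gives `dist(γ s, x) ≥ (x - q) e^{-L}/4` for all `s`;
* `ae_forall_pos_notMem_closure_range_sleTrace` — the SLE form: from a.s. non-swallowing of each
  `y > 0` and the a.s. bounds for each pair (hypotheses `hT`, `hP`, countably many), a.s. no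
  positive real is in the closure of the range of `sleTrace κ ω` (given `HasSLETrace κ`);
* `posRealAvoidSet`, `mem_posRealAvoidSet_iff` — the measurable path-space event "no positive
  real point in the closure of the range" (one-sided version of
  `Literature.Probability.RandomPlanarGeometry.realAvoidSet`);
* `ae_forall_neg_notMem_closure_range_sleTrace_of_pos` (**reflection**): the same for the
  negative reals, by the symmetry `ξ ↦ -ξ` in law (`identDistrib_sleDriving_neg_shift`) under
  which the trace is reflected in the imaginary axis (`IsGeneratedByCurve.neg_conj`,
  `IsGeneratedByCurve.trace_eq_holds`); hence `ae_forall_ne_zero_notMem_closure_range_sleTrace`,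
  the simultaneous form of Lemma 7.2 from `hT` and `hP`.

## References

* S. Rohde, O. Schramm, *Basic properties of SLE*, Ann. of Math. 161 (2005), Lemma 7.2 and
  its proof (p. 909); §6 p. 901 ("The proof that it a.s. does not intersect `(-∞, 0)` is the
  same").
* G. F. Lawler, *Conformally Invariant Processes in the Plane*, AMS (2005), Thm. 3.17, §4.1.
-/

noncomputable section

open Set Filter Topology MeasureTheory ProbabilityTheory Complex Metric
open UpperHalfPlane (upperHalfPlaneSet isOpen_upperHalfPlaneSet)
open scoped NNReal ComplexConjugate

namespace Literature.Probability.RandomPlanarGeometry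

/-! ### Deterministic part -/

namespace Loewner

variable {W : ℝ≥0 → ℝ} {γ : ℝ≥0 → ℂ}

/-- **`log |g_t'(x)| - log |g_t'(y)| = ∫₀ᵗ (2/Y_s² - 2/X_s²) ds`** for `W 0 < y ≤ x`, `t < T_y`
(`log |g_t'(z)| = ∫₀ᵗ -2/Z_s² ds`, `log_norm_deriv_map_ofReal`). [cite: RohdeSchramm2005, eq. (3.3)] -/
theorem log_norm_deriv_map_ofReal_sub_eq_integral (hW : Continuous W) {x y : ℝ} (hy : W 0 < y)
    (hyx : y ≤ x) {t : ℝ≥0} (ht : (t : WithTop ℝ≥0) < swallowingTime W y) :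
    Real.log ‖deriv (map W t) x‖ - Real.log ‖deriv (map W t) y‖ =
      ∫ s in (0 : ℝ)..t, (2 / realFlow W y s.toNNReal ^ 2 - 2 / realFlow W x s.toNNReal ^ 2) := by
  have hx : W 0 < x := hy.trans_le hyx
  have htx : (t : WithTop ℝ≥0) < swallowingTime W x :=
    lt_of_lt_of_le ht (swallowingTime_mono_right hW hy hyx)
  rw [log_norm_deriv_map_ofReal hW hx htx, log_norm_deriv_map_ofReal hW hy ht]
  have hcy := continuousOn_realFlow_toNNReal hW hy ht
  have hcx := continuousOn_realFlow_toNNReal hW hx htx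
  have hpos : ∀ s ∈ Icc (0 : ℝ) t, 0 < realFlow W y s.toNNReal := fun s hs ↦
    realFlow_pos hW hy (lt_of_le_of_lt (WithTop.coe_le_coe.2 (Real.toNNReal_le_iff_le_coe.2 hs.2)) ht)
  have hposx : ∀ s ∈ Icc (0 : ℝ) t, 0 < realFlow W x s.toNNReal := fun s hs ↦
    realFlow_pos hW hx (lt_of_le_of_lt (WithTop.coe_le_coe.2 (Real.toNNReal_le_iff_le_coe.2 hs.2)) htx)
  have hIy : IntervalIntegrable (fun s : ℝ ↦ 2 / realFlow W y s.toNNReal ^ 2) volume 0 t :=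
    ((continuousOn_const.div (hcy.pow 2) fun s hs ↦ (pow_pos (hpos s hs) 2).ne').mono
      (by rw [uIcc_of_le t.coe_nonneg])).intervalIntegrable
  have hIx : IntervalIntegrable (fun s : ℝ ↦ 2 / realFlow W x s.toNNReal ^ 2) volume 0 t :=
    ((continuousOn_const.div (hcx.pow 2) fun s hs ↦ (pow_pos (hposx s hs) 2).ne').mono
      (by rw [uIcc_of_le t.coe_nonneg])).intervalIntegrable
  rw [intervalIntegral.integral_sub hIy hIx]
  have h1 : ∫ s in (0 : ℝ)..t, -2 / realFlow W x s.toNNReal ^ 2 = -∫ s in (0 : ℝ)..t, 2 / realFlow W x s.toNNReal ^ 2 := by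
    rw [← intervalIntegral.integral_neg]
    refine intervalIntegral.integral_congr fun s _ ↦ ?_
    simp only [neg_div]
  have h2 : ∫ s in (0 : ℝ)..t, -2 / realFlow W y s.toNNReal ^ 2 = -∫ s in (0 : ℝ)..t, 2 / realFlow W y s.toNNReal ^ 2 := by
    rw [← intervalIntegral.integral_neg]
    refine intervalIntegral.integral_congr fun s _ ↦ ?_
    simp only [neg_div]
  rw [h1, h2]
  ring

/-- **No positive real point in `cl γ[0, ∞)` from bounds on `g_t'(q')/g_t'(q)`** (Rohde–Schramm
(2005), proof of Lemma 7.2, Koebe route, made simultaneous in the point): let the chain of the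
continuous `W` with `W 0 = 0` be generated by `γ`; if no positive rational is ever swallowed and
for all rationals `0 < q < q'` the increasing function `t ↦ log |g_t'(q')| - log |g_t'(q)|` is
bounded, then for every real `x > 0`, `x ∉ cl γ[0, ∞)`. Proof: choose rationals `0 < q < x ≤ q'`
and a bound `L`; by `IsGeneratedByCurve.le_dist_apply_ofReal'`,
`dist(γ s, x) ≥ (x - q) |g_s'(q)| / (4 |g_s'(q')|) ≥ (x - q) e^{-L} / 4 > 0` for every `s`.
[cite: RohdeSchramm2005, proof of Lemma 7.2 (p. 909)] -/
theorem IsGeneratedByCurve.ofReal_notMem_closure_range_of_bounds (hW : Continuous W) (hW0 : W 0 = 0)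
    (hγ : IsGeneratedByCurve W γ)
    (hT : ∀ q : ℚ, 0 < (q : ℝ) → swallowingTime W (q : ℝ) = ⊤)
    (hP : ∀ q q' : ℚ, 0 < (q : ℝ) → (q : ℝ) < q' → ∃ L : ℝ, ∀ t : ℝ≥0,
      Real.log ‖deriv (map W t) (q' : ℝ)‖ - Real.log ‖deriv (map W t) (q : ℝ)‖ ≤ L)
    {x : ℝ} (hx : 0 < x) : (x : ℂ) ∉ closure (range γ) := by
  obtain ⟨q, hq0, hqx⟩ := exists_rat_btwn hx
  obtain ⟨q', hxq', -⟩ := exists_rat_btwn (show x < x + 1 by linarith)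
  have hq0' : (0 : ℝ) < q := by exact_mod_cast hq0
  have hqq' : (q : ℝ) < q' := hqx.trans hxq'
  obtain ⟨L, hL⟩ := hP q q' hq0' hqq'
  have hyW : W 0 < q := by rw [hW0]; exact hq0'
  set ρ : ℝ := (x - q) * Real.exp (-L) / 4 with hρ
  have hρpos : 0 < ρ := by
    have : 0 < x - q := sub_pos.2 hqx
    positivity
  -- every point of the curve is at distance `≥ ρ` from `x`
  have hfar : ∀ s : ℝ≥0, ρ ≤ dist (γ s) x := by
    intro s
    have hs : (s : WithTop ℝ≥0) < swallowingTime W (q : ℝ) := by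
      rw [hT q hq0']; exact WithTop.coe_lt_top s
    have h1 := hγ.le_dist_apply_ofReal' hW hyW hqx hxq'.le hs le_rfl
    have hq'W : W 0 < q' := hyW.trans hqq'
    have hsq' : (s : WithTop ℝ≥0) < swallowingTime W (q' : ℝ) :=
      lt_of_lt_of_le hs (swallowingTime_mono_right hW hyW hqq'.le)
    have hpos₁ := norm_deriv_map_ofReal_pos hW hyW hs
    have hpos₂ := norm_deriv_map_ofReal_pos hW hq'W hsq'
    have hratio : Real.exp (-L) ≤ ‖deriv (map W s) (q : ℝ)‖ / ‖deriv (map W s) (q' : ℝ)‖ := by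
      rw [le_div_iff₀ hpos₂, ← Real.exp_log hpos₁, ← Real.exp_log hpos₂, ← Real.exp_add]
      exact Real.exp_le_exp.2 (by linarith [hL s])
    calc ρ = (x - q) * Real.exp (-L) / 4 := rfl
      _ ≤ (x - q) * (‖deriv (map W s) (q : ℝ)‖ / ‖deriv (map W s) (q' : ℝ)‖) / 4 := by
          gcongr
      _ = (x - q) * ‖deriv (map W s) (q : ℝ)‖ / (4 * ‖deriv (map W s) (q' : ℝ)‖) := by
          field_simp
      _ ≤ dist (γ s) x := h1
  -- hence `x` is not in the closure of the range
  rw [Metric.mem_closure_iff]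
  push Not
  refine ⟨ρ, hρpos, ?_⟩
  rintro _ ⟨s, rfl⟩
  rw [dist_comm]
  exact hfar s

end Loewner

/-! ### The SLE form, positive reals -/

section SLE

variable {κ : ℝ≥0}

/-- **No positive real point in `cl γ[0, ∞)`, a.s., from the two stochastic inputs** (SLE_κ
generated by a curve, `h0`): a.s. non-swallowing of each `y > 0` (`hT`; for `κ ≤ 4` this is
`ae_sle_swallowingTime_eq_top_of_le_four`) and, for each pair `0 < y < x`, an a.s. bound on
`t ↦ log |g_t'(x)| - log |g_t'(y)|` (`hP`). Countably many instances (rational points) feed the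
deterministic `Loewner.IsGeneratedByCurve.ofReal_notMem_closure_range_of_bounds`.
[cite: RohdeSchramm2005, Lemma 7.2] -/
theorem ae_forall_pos_notMem_closure_range_sleTrace (h0 : HasSLETrace κ)
    (hT : ∀ y : ℝ, 0 < y → ∀ᵐ ω ∂Process.preWienerMeasure, Loewner.swallowingTime (sleDriving κ ω) y = ⊤)
    (hP : ∀ x y : ℝ, 0 < y → y < x → ∀ᵐ ω ∂Process.preWienerMeasure, ∃ L : ℝ, ∀ t : ℝ≥0,
      Real.log ‖deriv (sleMap κ ω t) x‖ - Real.log ‖deriv (sleMap κ ω t) y‖ ≤ L) :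
    ∀ᵐ ω ∂Process.preWienerMeasure, ∀ x : ℝ, 0 < x → (x : ℂ) ∉ closure (range (sleTrace κ ω)) := by
  have hT' : ∀ᵐ ω ∂Process.preWienerMeasure, ∀ q : ℚ, 0 < (q : ℝ) →
      Loewner.swallowingTime (sleDriving κ ω) (q : ℝ) = ⊤ := by
    rw [ae_all_iff]
    intro q
    by_cases hq : 0 < (q : ℝ)
    · filter_upwards [hT q hq] with ω hω _ using hω
    · exact ae_of_all _ fun ω h ↦ absurd h hq
  have hP' : ∀ᵐ ω ∂Process.preWienerMeasure, ∀ q q' : ℚ, 0 < (q : ℝ) → (q : ℝ) < q' →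
      ∃ L : ℝ, ∀ t : ℝ≥0,
        Real.log ‖deriv (sleMap κ ω t) (q' : ℝ)‖ - Real.log ‖deriv (sleMap κ ω t) (q : ℝ)‖ ≤ L := by
    rw [ae_all_iff]
    intro q
    rw [ae_all_iff]
    intro q'
    by_cases hq : 0 < (q : ℝ)
    · by_cases hqq' : (q : ℝ) < q'
      · filter_upwards [hP q' q hq hqq'] with ω hω _ _ using hω
      · exact ae_of_all _ fun ω _ h ↦ absurd h hqq'
    · exact ae_of_all _ fun ω h ↦ absurd h hq
  filter_upwards [h0, hT', hP'] with ω hω hTω hPω x hx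
  exact (Loewner.isGeneratedByCurve_trace hω).ofReal_notMem_closure_range_of_bounds
    (continuous_sleDriving κ ω) (sleDriving_zero κ ω) hTω hPω hx

end SLE

/-! ### A one-sided measurable event and the reflection `ξ ↦ -ξ` -/

section Reflection

variable {κ : ℝ≥0}

/-- The compact pieces `A⁺ₙ = {x ∈ ℝ : 1/(n+1) ≤ x ≤ n+1}` of `(0, ∞)`, seen in `ℂ`. [folklore] -/
def posRealAnnulus (n : ℕ) : Set ℂ :=
  {z : ℂ | z.im = 0 ∧ 1 / ((n : ℝ) + 1) ≤ z.re ∧ z.re ≤ (n : ℝ) + 1}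

/-- `A⁺ₙ ⊆ Aₙ` (the symmetric pieces of `SLETransienceSimple`). [folklore] -/
theorem posRealAnnulus_subset_realAnnulus (n : ℕ) : posRealAnnulus n ⊆ realAnnulus n := by
  rintro z ⟨him, h1, h2⟩
  have hpos : 0 < z.re := lt_of_lt_of_le (by positivity) h1
  exact ⟨him, by rwa [abs_of_pos hpos], by rwa [abs_of_pos hpos]⟩

/-- `A⁺ₙ` is compact. [folklore] -/
theorem isCompact_posRealAnnulus (n : ℕ) : IsCompact (posRealAnnulus n) := by
  refine (isCompact_realAnnulus n).of_isClosed_subset ?_ (posRealAnnulus_subset_realAnnulus n)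
  exact (isClosed_eq Complex.continuous_im continuous_const).inter
    ((isClosed_le continuous_const Complex.continuous_re).inter
      (isClosed_le Complex.continuous_re continuous_const))

/-- `1 ∈ A⁺ₙ`. [folklore] -/
theorem one_mem_posRealAnnulus (n : ℕ) : (1 : ℂ) ∈ posRealAnnulus n := by
  refine ⟨by simp, ?_, ?_⟩
  · rw [Complex.one_re, div_le_one (by positivity)]
    linarith [n.cast_nonneg (α := ℝ)]
  · rw [Complex.one_re]
    linarith [n.cast_nonneg (α := ℝ)]

/-- A positive real point lies in some `A⁺ₙ`. [folklore] -/
theorem exists_ofReal_mem_posRealAnnulus {x : ℝ} (hx : 0 < x) : ∃ n : ℕ, (x : ℂ) ∈ posRealAnnulus n := by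
  obtain ⟨n, hn⟩ := exists_ofReal_mem_realAnnulus hx.ne'
  obtain ⟨him, h1, h2⟩ := hn
  rw [Complex.ofReal_re, abs_of_pos hx] at h1 h2
  exact ⟨n, him, by simpa using h1, by simpa using h2⟩

/-- Points of `A⁺ₙ` are positive reals. [folklore] -/
theorem eq_ofReal_of_mem_posRealAnnulus {n : ℕ} {z : ℂ} (hz : z ∈ posRealAnnulus n) :
    z = ((z.re : ℝ) : ℂ) ∧ 0 < z.re := by
  obtain ⟨him, hge, -⟩ := hz
  exact ⟨Complex.ext (by simp) (by simp [him]), lt_of_lt_of_le (by positivity) hge⟩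

/-- The path-space event "**no positive real point is in the closure of the range**", measurable
for the product σ-algebra (one-sided version of `realAvoidSet`). [folklore] -/
def posRealAvoidSet : Set (ℝ≥0 → ℂ) :=
  ⋂ n : ℕ, ⋃ k : ℕ, ⋂ q : ℚ, {p | 1 / ((k : ℝ) + 1) ≤ infDist (p (q : ℝ).toNNReal) (posRealAnnulus n)}

/-- `posRealAvoidSet` is measurable. [folklore] -/
theorem measurableSet_posRealAvoidSet : MeasurableSet posRealAvoidSet := by
  refine MeasurableSet.iInter fun n ↦ MeasurableSet.iUnion fun k ↦ MeasurableSet.iInter fun q ↦ ?_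
  exact measurableSet_le measurable_const
    ((continuous_infDist_pt (posRealAnnulus n)).measurable.comp (measurable_pi_apply _))

/-- For a **continuous** path `p`, `p ∈ posRealAvoidSet` iff no positive real point lies in the
closure of `range p` (as `mem_realAvoidSet_iff`). [folklore] -/
theorem mem_posRealAvoidSet_iff {p : ℝ≥0 → ℂ} (hp : Continuous p) :
    p ∈ posRealAvoidSet ↔ ∀ x : ℝ, 0 < x → (x : ℂ) ∉ closure (range p) := by
  simp only [posRealAvoidSet, mem_iInter, mem_iUnion, mem_setOf_eq]
  constructor
  · intro h x hx hxcl
    obtain ⟨n, hn⟩ := exists_ofReal_mem_posRealAnnulus hx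
    obtain ⟨k, hk⟩ := h n
    have hkpos : (0 : ℝ) < 1 / ((k : ℝ) + 1) := by positivity
    have hall : ∀ t : ℝ≥0, 1 / ((k : ℝ) + 1) ≤ infDist (p t) (posRealAnnulus n) := by
      intro t
      by_contra hlt
      rw [not_le] at hlt
      have ho : IsOpen {u : ℝ≥0 | infDist (p u) (posRealAnnulus n) < 1 / ((k : ℝ) + 1)} :=
        isOpen_lt ((continuous_infDist_pt _).comp hp) continuous_const
      obtain ⟨δ, hδ, hball⟩ := Metric.isOpen_iff.1 ho t hlt
      obtain ⟨q, htq, hqt⟩ := exists_rat_btwn (show (t : ℝ) < t + δ by linarith)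
      have hq0 : (0 : ℝ) ≤ q := t.2.trans htq.le
      have hmem : (q : ℝ).toNNReal ∈ {u : ℝ≥0 | infDist (p u) (posRealAnnulus n) < 1 / ((k : ℝ) + 1)} := by
        refine hball ?_
        rw [Metric.mem_ball, NNReal.dist_eq, Real.coe_toNNReal _ hq0, abs_sub_lt_iff]
        constructor <;> linarith
      exact absurd (hk q) (not_le.2 hmem)
    obtain ⟨_, ⟨t, rfl⟩, hdist⟩ := Metric.mem_closure_iff.1 hxcl _ hkpos
    have h1 : infDist (p t) (posRealAnnulus n) ≤ dist (p t) x := infDist_le_dist_of_mem hn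
    rw [dist_comm] at hdist
    linarith [hall t]
  · intro h n
    have hne : (range p).Nonempty := range_nonempty p
    obtain ⟨z₀, hz₀, hmin⟩ := (isCompact_posRealAnnulus n).exists_isMinOn ⟨1, one_mem_posRealAnnulus n⟩
      (continuous_infDist_pt (range p)).continuousOn
    obtain ⟨hz₀eq, hz₀pos⟩ := eq_ofReal_of_mem_posRealAnnulus hz₀
    have hpos : 0 < infDist z₀ (range p) := by
      rw [hz₀eq]
      exact (Metric.infDist_pos_iff_notMem_closure hne).1 (h _ hz₀pos)
    obtain ⟨k, hk⟩ := exists_nat_one_div_lt hpos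
    refine ⟨k, fun q ↦ ?_⟩
    refine (Metric.le_infDist ⟨1, one_mem_posRealAnnulus n⟩).2 fun y hy ↦ ?_
    have h1 : infDist z₀ (range p) ≤ infDist y (range p) := hmin hy
    have h2 : infDist y (range p) ≤ dist y (p (q : ℝ).toNNReal) := infDist_le_dist_of_mem (mem_range_self _)
    rw [dist_comm] at h2
    linarith

/-- **The reflected trace has the law of the trace**: `t ↦ -conj (γ t)` and `γ = sleTrace κ ω`
are identically distributed on the path space (given `HasSLETrace κ`). The driving functions
`ξ` and `-ξ` have the same law (`identDistrib_sleDriving_neg_shift` at `s = 0`), the chain of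
`-ξ` is generated by `-γ̄` (`IsGeneratedByCurve.neg_conj`), and the trace is a measurable
functional of the driving function (`Loewner.exists_measurable_eq_trace`). Rohde–Schramm (2005),
§6 p. 901 ("by symmetry"). [cite: RohdeSchramm2005, Prop. 2.1] -/
theorem identDistrib_sleTrace_negConj (h0 : HasSLETrace κ) :
    IdentDistrib (fun ω ↦ sleTrace κ ω) (fun ω t ↦ -conj (sleTrace κ ω t))
      Process.preWienerMeasure Process.preWienerMeasure := by
  obtain ⟨T, hTm, hT⟩ := Loewner.exists_measurable_eq_trace
  have hlaw : IdentDistrib (fun ω t ↦ sleDriving κ ω t) (fun ω t ↦ -sleDriving κ ω t)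
      Process.preWienerMeasure Process.preWienerMeasure := by
    have h := identDistrib_sleDriving_neg_shift (κ := κ) 0
    have heq : (fun (ω : ℝ≥0 → ℝ) (t : ℝ≥0) ↦ -(sleDriving κ ω (0 + t) - sleDriving κ ω 0)) =
        fun ω t ↦ -sleDriving κ ω t := by
      funext ω t
      simp [sleDriving_zero]
    rwa [heq] at h
  have hcomp := hlaw.comp hTm
  have h1 : (T ∘ fun ω t ↦ sleDriving κ ω t) =ᵐ[Process.preWienerMeasure] fun ω ↦ sleTrace κ ω := by
    filter_upwards [h0] with ω hω
    exact hT _ (continuous_sleDriving κ ω) hω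
  have h2 : (T ∘ fun ω t ↦ -sleDriving κ ω t) =ᵐ[Process.preWienerMeasure]
      fun ω t ↦ -conj (sleTrace κ ω t) := by
    filter_upwards [h0] with ω hω
    have hgen := (Loewner.isGeneratedByCurve_trace hω).neg_conj
    have hWc : Continuous fun s ↦ -sleDriving κ ω s := (continuous_sleDriving κ ω).neg
    show T (fun t ↦ -sleDriving κ ω t) = fun t ↦ -conj (sleTrace κ ω t)
    rw [hT _ hWc ⟨_, hgen⟩]
    exact Loewner.IsGeneratedByCurve.trace_eq_holds hWc hgen
  have hm1 : AEMeasurable (T ∘ fun ω t ↦ sleDriving κ ω t) Process.preWienerMeasure :=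
    (hTm.comp (measurable_sleDriving_pi κ)).aemeasurable
  have hm2 : AEMeasurable (T ∘ fun ω t ↦ -sleDriving κ ω t) Process.preWienerMeasure :=
    (hTm.comp (measurable_pi_lambda _ fun t ↦ (measurable_sleDriving κ t).neg)).aemeasurable
  exact (IdentDistrib.of_ae_eq hm1 h1).symm.trans (hcomp.trans (IdentDistrib.of_ae_eq hm2 h2))

/-- **Negative reals by reflection**: if a.s. no positive real point lies in `cl γ[0, ∞)`, then
a.s. no negative real point does (`identDistrib_sleTrace_negConj` applied to the measurable event
`posRealAvoidSet`; `-conj` maps `cl γ[0, ∞)` into the closure of the range of the reflected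
trace). Rohde–Schramm (2005), §6 p. 901 ("The proof that it a.s. does not intersect `(-∞, 0)` is
the same"). [cite: RohdeSchramm2005, Lemma 7.2] -/
theorem ae_forall_neg_notMem_closure_range_sleTrace_of_pos (h0 : HasSLETrace κ)
    (hpos : ∀ᵐ ω ∂Process.preWienerMeasure, ∀ x : ℝ, 0 < x → (x : ℂ) ∉ closure (range (sleTrace κ ω))) :
    ∀ᵐ ω ∂Process.preWienerMeasure, ∀ x : ℝ, x < 0 → (x : ℂ) ∉ closure (range (sleTrace κ ω)) := by
  have hlaw := identDistrib_sleTrace_negConj h0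
  have h1 : ∀ᵐ ω ∂Process.preWienerMeasure, sleTrace κ ω ∈ posRealAvoidSet := by
    filter_upwards [h0, hpos] with ω hω h
    exact (mem_posRealAvoidSet_iff (Loewner.isGeneratedByCurve_trace hω).continuous).2 h
  have h2 : Process.preWienerMeasure ((fun ω t ↦ -conj (sleTrace κ ω t)) ⁻¹' posRealAvoidSetᶜ) = 0 := by
    rw [← hlaw.measure_mem_eq measurableSet_posRealAvoidSet.compl]
    refine measure_eq_zero_iff_ae_notMem.2 ?_
    filter_upwards [h1] with ω hω
    simpa using hω
  have h3 : ∀ᵐ ω ∂Process.preWienerMeasure, (fun t ↦ -conj (sleTrace κ ω t)) ∈ posRealAvoidSet := by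
    filter_upwards [measure_eq_zero_iff_ae_notMem.1 h2] with ω hω
    simpa only [mem_preimage, mem_compl_iff, not_not] using hω
  filter_upwards [h0, h3] with ω hω hav x hx hxcl
  have hc : Continuous (sleTrace κ ω) := (Loewner.isGeneratedByCurve_trace hω).continuous
  have hφ : Continuous fun z : ℂ ↦ -conj z := Complex.continuous_conj.neg
  have hav' := (mem_posRealAvoidSet_iff (hφ.comp hc)).1 hav (-x) (by linarith)
  apply hav'
  have hsub := image_closure_subset_closure_image hφ (s := range (sleTrace κ ω))
  have hmem : (fun z : ℂ ↦ -conj z) (x : ℂ) ∈ closure ((fun z : ℂ ↦ -conj z) '' range (sleTrace κ ω)) :=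
    hsub (mem_image_of_mem _ hxcl)
  rw [← range_comp] at hmem
  have hx' : (fun z : ℂ ↦ -conj z) (x : ℂ) = ((-x : ℝ) : ℂ) := by simp
  rw [hx'] at hmem
  exact hmem

/-- **The simultaneous form of Lemma 7.2 from the two stochastic inputs**: under the hypotheses
of `ae_forall_pos_notMem_closure_range_sleTrace` (`HasSLETrace κ`, a.s. non-swallowing of each
`y > 0`, a.s. bounds on `log |g_t'(x)| - log |g_t'(y)|` for each pair), almost surely no nonzero
real point lies in `cl γ[0, ∞)`. [cite: RohdeSchramm2005, Lemma 7.2] -/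
theorem ae_forall_ne_zero_notMem_closure_range_sleTrace (h0 : HasSLETrace κ)
    (hT : ∀ y : ℝ, 0 < y → ∀ᵐ ω ∂Process.preWienerMeasure, Loewner.swallowingTime (sleDriving κ ω) y = ⊤)
    (hP : ∀ x y : ℝ, 0 < y → y < x → ∀ᵐ ω ∂Process.preWienerMeasure, ∃ L : ℝ, ∀ t : ℝ≥0,
      Real.log ‖deriv (sleMap κ ω t) x‖ - Real.log ‖deriv (sleMap κ ω t) y‖ ≤ L) :
    ∀ᵐ ω ∂Process.preWienerMeasure, ∀ x : ℝ, x ≠ 0 → (x : ℂ) ∉ closure (range (sleTrace κ ω)) := by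
  have hpos := ae_forall_pos_notMem_closure_range_sleTrace h0 hT hP
  filter_upwards [hpos, ae_forall_neg_notMem_closure_range_sleTrace_of_pos h0 hpos] with ω hp hn x hx
  rcases lt_or_gt_of_ne hx with h | h
  · exact hn x h
  · exact hp x h

end Reflection

end Literature.Probability.RandomPlanarGeometry
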